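import Literature.AnabelianGeometry.SemiGraphs.GaloisLevelDataOfSeq
import Literature.AnabelianGeometry.SemiGraphs.TemperedPiLevelsConnected
import Literature.AnabelianGeometry.SemiGraphs.TemperedPiCoverMaps
import Literature.AnabelianGeometry.SemiGraphs.TemperedPiDecomposition
import Literature.AnabelianGeometry.SemiGraphs.CharacteristicOpenCore
import Literature.AnabelianGeometry.Anabelioids.GaloisObjectsOfOpenNormal
import Mathlib.Tactic.Group
import HarnessLib

/-!
# Galois level data with PRESCRIBED open normal stabilisers — the characteristic Galois tower
# ([SemiAnbd] Prop 3.6 p. 38, Prop 5.2 (i)/(iv) pp. 63–64)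

Mochizuki, *Semi-graphs of anabelioids*, Publ. RIMS **42** (2006), §3 p. 38 ("some cofinal collection of
connected finite étale Galois coverings … `π̂₁(G) = lim Gal(G_i/G)` … `π₁^temp(G) := lim Gal(G_{∞,i}/G)`"),
§5 Prop 5.2 (i) p. 63 (in the arithmetic situation the levels must be stable under the arithmetic action)
[cite: MochizukiSemiAnbd2006, Prop 3.6 p.38]; Dixon–du Sautoy–Mann–Segal, *Analytic pro-p groups*,
Prop. 1.6 (characteristic open subgroups) [cite: DixonEtAl1999, Prop 1.6].

Seat abc-iut-L3-t9 (Galois-tower lineage), E1 junction (J2c) of the abc-iut cell's row T54-B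
(`plan/GAP-LEDGER.md` G-w4d053-1).  From a PRESCRIBED antitone sequence `V k` of open NORMAL subgroups
of `π̂₁ := Aut(𝒢.fiberAt v₀)` (the fundamental group of the Galois category `B(𝒢)` at the base vertex) —
e.g. abc-iut-w4-d053/w4-d048's characteristic open cores `charOpenCore (Aut (𝒢.fiberAt v₀)) (d k)` — this
file builds:

* `openNormalObj V k` / `openNormalPt V k` — a GALOIS object `A_k` of `B(𝒢)` with a point of stabiliser
  EXACTLY `V k` (`Anabelioids.exists_isGalois_stabilizer_eq`); `stabilizer_eq_of_openNormalObj` — every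
  point of its `v₀`-fibre has stabiliser `V k`; `openNormalMap` — transitions `A_{k+1} ⟶ A_k` from
  `V (k+1) ≤ V k` (`exists_hom_of_stabilizer_le`);
* **`GaloisLevelData.ofOpenNormalSeq`** — the Galois level data `GaloisLevelData.ofGaloisSeq` over them
  (levels `ofBObj A_k`); its levels are connected (`ofOpenNormalSeq_hconn`), split themselves, are finite
  with nonempty fibres (from `GaloisLevelDataOfSeq.lean`);
* `ofOpenNormalSeq_dominates` / **`ofOpenNormalSeq_hcof`** — if `V k` eventually lies below the stabiliser
  of the base point of each level of abc-iut-L3-t9's tower `𝒢.galoisLevelData h36`, the prescribed tower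
  DOMINATES it, hence is COFINAL (every component of every tempered covering is split by its levels) — the
  input of the generic chart `GaloisLevelData.chart` (`GaloisLevelDataChart.lean`);
  `charOpenCore_le_stabilizer_basePoint` — characteristic open cores satisfy the domination hypothesis;
* `GaloisLevelData.nonempty_pointSeq_of_isConnected` — compatible point sequences over EVERY vertex exist
  for ANY Galois tower of a connected `𝒢` (fibre-surjectivity of the transition maps `levelMap`), the datum
  `T` of abc-iut-L3-d4's `piPresentation` for the new tower.

What this does NOT prove (sub-row (J2d), abc-iut-w4-d048/w6-d064): that the finite-level kernels
`ker π_k ⊆ (ofOpenNormalSeq …).temperedPi` of the new tower are characteristic in that tempered group (the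
transfer `Aut(fiberAt v₀) ↔ π₁^temp` of the characteristic open cores).  Nothing here takes a side on
[IUTchIII] Cor. 3.12; typed ≠ proved.
-/

namespace Literature.AnabelianGeometry.SemiGraphs

namespace ProfiniteSemiGraph

open CategoryTheory CategoryTheory.PreGaloisCategory Literature.AnabelianGeometry.Anabelioids
open scoped FintypeCatDiscrete

universe u

variable (𝒢 : ProfiniteSemiGraph.{u}) (hc : 𝒢.graph.IsConnected) (v₀ : 𝒢.graph.Vertex)

/-! ### Compatible point sequences exist for every tower -/

/-- **Compatible point sequences over every vertex exist for every Galois tower of a connected `𝒢`**: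
the fibre of `𝒢_{∞,S n}` over `w` is nonempty (its base point's component meets every vertex fibre) and the
transition maps `𝒢_{∞,S n+1} → 𝒢_{∞,S n}` are onto on fibres. [cite: MochizukiSemiAnbd2006, Thm 3.7(i) p.40] -/
theorem GaloisLevelData.nonempty_pointSeq_of_isConnected {𝒢 : ProfiniteSemiGraph.{u}}
    (D : GaloisLevelData 𝒢) (h𝒢 : 𝒢.IsCountable) (hc : 𝒢.graph.IsConnected) (w : 𝒢.graph.Vertex) :
    Nonempty (D.PointSeq h𝒢 w) := by
  have h0 : ∀ n, Nonempty (((D.cover h𝒢 n).SV w).obj.V) := fun n => by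
    obtain ⟨s, -⟩ := (D.cover h𝒢 n).exists_mem_component_over hc (D.bp n) w
    exact ⟨s⟩
  have hsurj : ∀ (n : ℕ) (x : ((D.cover h𝒢 n).SV w).obj.V),
      ∃ y : ((D.cover h𝒢 (n + 1)).SV w).obj.V, ((D.stepCover h𝒢 n).fV w).hom.hom y = x :=
    fun n x => D.levelMap_fV_surjective h𝒢 n w x
  let f : ∀ n, ((D.cover h𝒢 n).SV w).obj.V :=
    fun n => Nat.rec (motive := fun n => ((D.cover h𝒢 n).SV w).obj.V) (Classical.choice (h0 0))
      (fun n x => (hsurj n x).choose) n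
  exact ⟨⟨f, fun n => (hsurj n (f n)).choose_spec⟩⟩

/-! ### Galois objects with prescribed stabilisers, and their tower -/

section OpenNormal

variable (V : ℕ → OpenSubgroup (Aut (𝒢.fiberAt v₀))) (hVn : ∀ k, (V k).toSubgroup.Normal)
  (hanti : ∀ k, (V (k + 1)).toSubgroup ≤ (V k).toSubgroup)

include hc hVn in
/-- The data: a Galois object with a point of stabiliser `V k`. [cite: MochizukiSemiAnbd2006, Prop 3.6 p.38] -/
theorem exists_openNormal_data (k : ℕ) :
    ∃ (A : 𝒢.toAnab.BObj) (_ : letI := SemiGraphOfAnabelioids.galoisCategory_bObj 𝒢.toAnab ⟨hc⟩; IsGalois A)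
      (a : (𝒢.fiberAt v₀).obj A), MulAction.stabilizer (Aut (𝒢.fiberAt v₀)) a = (V k).toSubgroup := by
  letI := SemiGraphOfAnabelioids.galoisCategory_bObj 𝒢.toAnab ⟨hc⟩
  haveI := 𝒢.fiberFunctor_fiberAt hc v₀
  haveI := hVn k
  exact exists_isGalois_stabilizer_eq (𝒢.fiberAt v₀) (V k)

/-- **The Galois object `A_k` with prescribed stabiliser `V k`.** [cite: MochizukiSemiAnbd2006, Prop 3.6 p.38] -/
noncomputable def openNormalObj (k : ℕ) : 𝒢.toAnab.BObj :=
  (𝒢.exists_openNormal_data hc v₀ V hVn k).choose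

/-- `A_k` is Galois. [cite: MochizukiSemiAnbd2006, Prop 3.6 p.38] -/
theorem openNormalObj_isGalois (k : ℕ) :
    letI := SemiGraphOfAnabelioids.galoisCategory_bObj 𝒢.toAnab ⟨hc⟩
    IsGalois (𝒢.openNormalObj hc v₀ V hVn k) :=
  (𝒢.exists_openNormal_data hc v₀ V hVn k).choose_spec.choose

/-- The distinguished point of `A_k` over `v₀`. [cite: MochizukiSemiAnbd2006, Prop 3.6 p.38] -/
noncomputable def openNormalPt (k : ℕ) : (𝒢.fiberAt v₀).obj (𝒢.openNormalObj hc v₀ V hVn k) :=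
  (𝒢.exists_openNormal_data hc v₀ V hVn k).choose_spec.choose_spec.choose

/-- **Its stabiliser is `V k`.** [cite: MochizukiSemiAnbd2006, Prop 3.6 p.38] -/
theorem stabilizer_openNormalPt (k : ℕ) :
    MulAction.stabilizer (Aut (𝒢.fiberAt v₀)) (𝒢.openNormalPt hc v₀ V hVn k) = (V k).toSubgroup :=
  (𝒢.exists_openNormal_data hc v₀ V hVn k).choose_spec.choose_spec.choose_spec

include hVn in
/-- **Every point of the `v₀`-fibre of `A_k` has stabiliser `V k`** (`Aut F` is transitive on the fibre of
the connected `A_k`, and `V k` is normal). [cite: DixonEtAl1999, Prop 1.6] -/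
theorem stabilizer_eq_of_openNormalObj (k : ℕ) (x : (𝒢.fiberAt v₀).obj (𝒢.openNormalObj hc v₀ V hVn k)) :
    MulAction.stabilizer (Aut (𝒢.fiberAt v₀)) x = (V k).toSubgroup := by
  letI := SemiGraphOfAnabelioids.galoisCategory_bObj 𝒢.toAnab ⟨hc⟩
  haveI := 𝒢.fiberFunctor_fiberAt hc v₀
  haveI := (𝒢.openNormalObj_isGalois hc v₀ V hVn k).toIsConnected
  obtain ⟨σ, rfl⟩ := MulAction.exists_smul_eq (Aut (𝒢.fiberAt v₀)) (𝒢.openNormalPt hc v₀ V hVn k) x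
  rw [MulAction.stabilizer_smul_eq_stabilizer_map_conj, 𝒢.stabilizer_openNormalPt hc v₀ V hVn k]
  haveI := hVn k
  ext τ
  simp only [Subgroup.mem_map, MulEquiv.coe_toMonoidHom, MulAut.conj_apply]
  constructor
  · rintro ⟨x, hx, rfl⟩
    exact (hVn k).conj_mem x hx σ
  · intro hτ
    refine ⟨σ⁻¹ * τ * σ, ?_, by group⟩
    have h := (hVn k).conj_mem τ hτ σ⁻¹
    rwa [inv_inv] at h

include hanti in
/-- The data of the transition `A_{k+1} ⟶ A_k` carrying the distinguished points onto each other.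
[cite: MochizukiSemiAnbd2006, Prop 3.6 p.38] -/
theorem exists_openNormalMap (k : ℕ) :
    ∃ f : 𝒢.openNormalObj hc v₀ V hVn (k + 1) ⟶ 𝒢.openNormalObj hc v₀ V hVn k,
      (𝒢.fiberAt v₀).map f (𝒢.openNormalPt hc v₀ V hVn (k + 1)) = 𝒢.openNormalPt hc v₀ V hVn k := by
  letI := SemiGraphOfAnabelioids.galoisCategory_bObj 𝒢.toAnab ⟨hc⟩
  haveI := 𝒢.fiberFunctor_fiberAt hc v₀
  haveI := (𝒢.openNormalObj_isGalois hc v₀ V hVn (k + 1)).toIsConnected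
  refine exists_hom_of_stabilizer_le (𝒢.fiberAt v₀) _ _ ?_
  rw [𝒢.stabilizer_openNormalPt hc v₀ V hVn (k + 1), 𝒢.stabilizer_openNormalPt hc v₀ V hVn k]
  exact hanti k

/-- **The transition `A_{k+1} ⟶ A_k`.** [cite: MochizukiSemiAnbd2006, Prop 3.6 p.38] -/
noncomputable def openNormalMap (k : ℕ) :
    𝒢.openNormalObj hc v₀ V hVn (k + 1) ⟶ 𝒢.openNormalObj hc v₀ V hVn k :=
  (𝒢.exists_openNormalMap hc v₀ V hVn hanti k).choose

/-- It carries the distinguished points onto each other. [cite: MochizukiSemiAnbd2006, Prop 3.6 p.38] -/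
theorem map_openNormalMap_pt (k : ℕ) :
    (𝒢.fiberAt v₀).map (𝒢.openNormalMap hc v₀ V hVn hanti k) (𝒢.openNormalPt hc v₀ V hVn (k + 1)) =
      𝒢.openNormalPt hc v₀ V hVn k :=
  (𝒢.exists_openNormalMap hc v₀ V hVn hanti k).choose_spec

/-- **Galois level data with prescribed open normal stabilisers** (`ofGaloisSeq` over the `A_k`).
[cite: MochizukiSemiAnbd2006, Prop 3.6 p.38] -/
noncomputable def GaloisLevelData.ofOpenNormalSeq : GaloisLevelData 𝒢 :=
  GaloisLevelData.ofGaloisSeq 𝒢 hc v₀ (𝒢.openNormalObj hc v₀ V hVn) (𝒢.openNormalObj_isGalois hc v₀ V hVn)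
    (𝒢.openNormalMap hc v₀ V hVn hanti)

/-- The levels of `ofOpenNormalSeq` (definitional). [cite: MochizukiSemiAnbd2006, Prop 3.6 p.38] -/
theorem GaloisLevelData.ofOpenNormalSeq_S (k : ℕ) :
    (GaloisLevelData.ofOpenNormalSeq 𝒢 hc v₀ V hVn hanti).S k = 𝒢.ofBObj.obj (𝒢.openNormalObj hc v₀ V hVn k) :=
  rfl

/-- The levels are connected coverings (the `hconn` input of `piLevelAut`).
[cite: MochizukiSemiAnbd2006, Prop 3.6(i) p.38] -/
theorem GaloisLevelData.ofOpenNormalSeq_hconn (k : ℕ)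
    (p q : ((GaloisLevelData.ofOpenNormalSeq 𝒢 hc v₀ V hVn hanti).S k).Point) :
    ((GaloisLevelData.ofOpenNormalSeq 𝒢 hc v₀ V hVn hanti).S k).SameComponent p q :=
  letI := SemiGraphOfAnabelioids.galoisCategory_bObj 𝒢.toAnab ⟨hc⟩
  sameComponent_ofBObj_of_isConnected hc (𝒢.openNormalObj hc v₀ V hVn k)
    (𝒢.openNormalObj_isGalois hc v₀ V hVn k).toIsConnected p q

end OpenNormal

/-! ### Domination of the enumerated tower, cofinality -/

section Dominates

variable (h36 : 𝒢.Prop36Hypotheses) (V : ℕ → OpenSubgroup (Aut (𝒢.fiberAt (𝒢.baseVertex h36))))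

/-- **Domination**: if `V k` lies below the stabiliser of the base point of the `i`-th level of
abc-iut-L3-t9's tower `𝒢.galoisLevelData h36`, the `k`-th prescribed level maps to that level.
[cite: MochizukiSemiAnbd2006, Prop 3.6 p.38] -/
theorem GaloisLevelData.ofOpenNormalSeq_dominates (hVn' : ∀ k, (V k).toSubgroup.Normal)
    (hanti' : ∀ k, (V (k + 1)).toSubgroup ≤ (V k).toSubgroup) {i k : ℕ}
    (hik : (V k).toSubgroup ≤ MulAction.stabilizer (Aut (𝒢.fiberAt (𝒢.baseVertex h36))) (show (𝒢.fiberAt (𝒢.baseVertex h36)).obj (𝒢.tower h36 i) from 𝒢.basePoint h36 i)) :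
    Nonempty ((GaloisLevelData.ofOpenNormalSeq 𝒢 h36.isConnected (𝒢.baseVertex h36) V hVn' hanti').S k ⟶
      (𝒢.galoisLevelData h36).S i) := by
  letI := SemiGraphOfAnabelioids.galoisCategory_bObj 𝒢.toAnab ⟨h36.isConnected⟩
  haveI := 𝒢.fiberFunctor_fiberAt h36.isConnected (𝒢.baseVertex h36)
  haveI := (𝒢.openNormalObj_isGalois h36.isConnected (𝒢.baseVertex h36) V hVn' k).toIsConnected
  have h := hik
  rw [← 𝒢.stabilizer_openNormalPt h36.isConnected (𝒢.baseVertex h36) V hVn' k] at h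
  obtain ⟨f, -⟩ := exists_hom_of_stabilizer_le (𝒢.fiberAt (𝒢.baseVertex h36)) _ _ h
  exact ⟨𝒢.ofBObj.map f⟩

/-- **Cofinality of the prescribed tower**: if every `V k` is eventually below the base-point stabilisers
of the enumerated tower, every component of every tempered covering is split by the prescribed levels from
some level on (the input `hcof` of `GaloisLevelData.chart`). [cite: MochizukiSemiAnbd2006, Prop 3.6 p.38] -/
theorem GaloisLevelData.ofOpenNormalSeq_hcof (hVn' : ∀ k, (V k).toSubgroup.Normal)
    (hanti' : ∀ k, (V (k + 1)).toSubgroup ≤ (V k).toSubgroup)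
    (hdom : ∀ i, ∃ k, (V k).toSubgroup ≤
      MulAction.stabilizer (Aut (𝒢.fiberAt (𝒢.baseVertex h36))) (show (𝒢.fiberAt (𝒢.baseVertex h36)).obj (𝒢.tower h36 i) from 𝒢.basePoint h36 i))
    (T : CovObj 𝒢) (hT : T.IsTempered) (p : T.Point) :
    ∃ n : ℕ, ∀ m, n ≤ m →
      ((GaloisLevelData.ofOpenNormalSeq 𝒢 h36.isConnected (𝒢.baseVertex h36) V hVn' hanti').S m).Splits
        (T.component p) :=
  GaloisLevelData.ofGaloisSeq_exists_level_splits_component_of_dominates 𝒢 (𝒢.baseVertex h36) _ _ h36 _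
    (fun i => by
      obtain ⟨k, hk⟩ := hdom i
      exact ⟨k, GaloisLevelData.ofOpenNormalSeq_dominates 𝒢 h36 V hVn' hanti' hk⟩) T hT p

/-! ### Characteristic open cores satisfy the domination hypothesis -/

/-- The stabiliser of the base point of a level of the enumerated tower is open of finite index, so the
characteristic open core of its index lies below it. [cite: DixonEtAl1999, Prop 1.6] -/
theorem charOpenCore_le_stabilizer_basePoint (i : ℕ) :
    ∃ d : ℕ, charOpenCore (Aut (𝒢.fiberAt (𝒢.baseVertex h36))) d ≤
      MulAction.stabilizer (Aut (𝒢.fiberAt (𝒢.baseVertex h36))) (show (𝒢.fiberAt (𝒢.baseVertex h36)).obj (𝒢.tower h36 i) from 𝒢.basePoint h36 i) := by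
  letI := SemiGraphOfAnabelioids.galoisCategory_bObj 𝒢.toAnab ⟨h36.isConnected⟩
  haveI := 𝒢.fiberFunctor_fiberAt h36.isConnected (𝒢.baseVertex h36)
  set U := MulAction.stabilizer (Aut (𝒢.fiberAt (𝒢.baseVertex h36))) (show (𝒢.fiberAt (𝒢.baseVertex h36)).obj (𝒢.tower h36 i) from 𝒢.basePoint h36 i) with hU
  have hUo : IsOpen (U : Set (Aut (𝒢.fiberAt (𝒢.baseVertex h36)))) := stabilizer_isOpen _ _
  haveI : Finite (Aut (𝒢.fiberAt (𝒢.baseVertex h36)) ⧸ U) := U.quotient_finite_of_isOpen hUo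
  haveI : U.FiniteIndex := Subgroup.finiteIndex_of_finite_quotient
  exact ⟨U.index, charOpenCore_le_of_finiteIndex U hUo⟩

end Dominates

end ProfiniteSemiGraph

end Literature.AnabelianGeometry.SemiGraphs
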